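import Summits.Ventures.LatticeQCDFlow.Scaling.HubAcceptanceLaw
import Summits.Ventures.LatticeQCDFlow.Scaling.SwapGraphDilution
import Summits.Ventures.LatticeQCDFlow.Scaling.TemperingMixingTimeFloor

/-!
HONEST FRAMING: exact (Metropolis-corrected) sampling algorithms for lattice gauge theory; figures
of merit are autocorrelation/cost numbers at stated couplings and volumes; no continuum-physics
claim.

# ColdReplicaMixingFloor — COLD-START MIXING FLOORS FROM THE PROPOSAL LAW: AN EXCHANGE SCHEME ON ANY SWAP LIST THAT
# IS `ε`-CLOSE TO EQUILIBRIUM AT SOME TIME NEEDS `t_mix(ε) ≥ (2m·μ_k(A)μ_k(Aᶜ)/(t·deg(k)) − 1)·log(1/(2ε))` STEPS FOR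
# EVERY IDLE COLD REPLICA `k`, `≥ (2m·μ_k(A)μ_k(Aᶜ)/(t·Σ_{r∋k}α_r) − 1)·log(1/(2ε))` WITH ITS MEASURED ACCEPTANCES,
# AND `≥ (m·K·v/(t·h·min{μ_0(A),μ_0(Aᶜ)}) − 1)·log(1/(2ε))` FROM THE HOT DEGREE (lean-2 GEN-23, ours)

Venture-side (OURS).  Cell `lqcd-flow` (pub-lqcd), unit `pub-lqcd-lean-2-g23`, 2026-08-26.  Chapter K, file 14: the
gap ceilings of `Scaling/HubProposalLaw` (K2), `Scaling/HubAcceptanceLaw` (K9) and `Scaling/SwapGraphDilution` (K1)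
turned into mixing-time floors by `Scaling/TemperingMixingTimeFloor`'s `mixingTime_ge_of_spectralGap_le`
(Levin–Peres–Wilmer Theorem 12.5 at the second eigenvalue: `t_mix(ε) ≥ (t_rel − 1)·log(1/(2ε))`).  Scheme
`P = t·ptGraphSwap μ e φ + (1−t)·prodKernel w M` on an edge list `e` of `m` entries with sector-preserving maps,
irreducible, `ε`-close to `π̃` at some time (`0 < ε ≤ ½`).

## What is proved

* **`idleReplica_mixingTime_ge`** — replica `k` idle (`w_k·Q_k(A,Aᶜ) = 0`), `t·deg(k) < 2m·μ_k(A)μ_k(Aᶜ)`: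
  `t_mix(ε) ≥ (2m·μ_k(A)μ_k(Aᶜ)/(t·deg(k)) − 1)·log(1/(2ε))`.
* **`acceptance_mixingTime_ge`** — the same with the measured acceptances: `t·Σ_{r∋k}α_r < 2m·μ_k(A)μ_k(Aᶜ)` ⇒
  `t_mix(ε) ≥ (2m·μ_k(A)μ_k(Aᶜ)/(t·Σ_{r∋k}α_r) − 1)·log(1/(2ε))`.
* **`dilutedHandover_mixingTime_ge`** — all cold replicas idle, `μ_k(A)μ_k(Aᶜ) ≥ v` (`k ≠ 0`),
  `t·h·min{μ_0(A),μ_0(Aᶜ)} < m·K·v` ⇒ `t_mix(ε) ≥ (m·K·v/(t·h·min{μ_0(A),μ_0(Aᶜ)}) − 1)·log(1/(2ε))`.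

Reading (no numerics implied): from a cold start an exchange sampler with `m` proposal entries cannot equilibrate a
replica proposed `deg(k)` times out of `m` in fewer than order `m/(t·deg(k))` steps (times `log(1/(2ε))`), and the
whole array in fewer than order `mK/(t·h)` — the converse of the lazy mixing ceilings of `Scaling/HubListCurrencies`.
NOT CLAIMED: the matching `log` factors; continuous spaces; anything measured.  Literature grade (cell rule): OWN
COMPOSITION (K1/K2/K9 + LPW Thm 12.5 as typed); nothing cited as a fact; no new bib keys.
-/

noncomputable section

open Finset Function
open Literature.Probability.MarkovChains

namespace Summit.Ventures.LatticeQCDFlow.Scaling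

variable {S : Type*} [Fintype S] [DecidableEq S] {K m : ℕ} {μ : Fin (K + 1) → S → ℝ}
  {M : Fin (K + 1) → S → S → ℝ} {w : Fin (K + 1) → ℝ} {t : ℝ} {e : Fin m → Fin (K + 1) × Fin (K + 1)}
  {φ : Fin m → Equiv.Perm S}

omit [Fintype S] [DecidableEq S] in
/-- Inverting a ceiling of the form `a/b`: `1/(a/b) − 1 = b/a − 1`. [ours] -/
theorem inv_div_sub_one (a b : ℝ) : 1 / (a / b) - 1 = b / a - 1 := by rw [one_div_div]

/-- **COLD-START FLOOR FROM AN IDLE REPLICA'S LIST-DEGREE:** `P` irreducible, `ε`-close to `π̃` at some time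
(`0 < ε ≤ ½`), replica `k` idle with `μ_k(A)μ_k(Aᶜ) > 0` and `t·deg(k) < 2m·μ_k(A)μ_k(Aᶜ)`:
**`t_mix(ε) ≥ (2m·μ_k(A)μ_k(Aᶜ)/(t·deg(k)) − 1)·log(1/(2ε))`**. [ours] -/
theorem idleReplica_mixingTime_ge [Nontrivial S] (hm : 1 ≤ m) (he : ∀ r, (e r).1 ≠ (e r).2) (hμ : ∀ k x, 0 < μ k x)
    (hμ1 : ∀ k, ∑ u, μ k u = 1) (hM : ∀ k, IsRowStochastic (M k)) (hMrev : ∀ k, DetailedBalance (μ k) (M k))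
    (hw0 : ∀ k, 0 ≤ w k) (hw1 : ∑ k, w k = 1) (ht0 : 0 ≤ t) (ht1 : t ≤ 1) {A : Finset S}
    (hφA : ∀ r u, φ r u ∈ A ↔ u ∈ A) (k : Fin (K + 1)) (hAk : 0 < (∑ u ∈ A, μ k u) * ∑ u ∈ Aᶜ, μ k u)
    (hidle : w k * edgeMeasure (μ k) (M k) A Aᶜ = 0)
    (hsmall : t * ((univ.filter (fun r : Fin m => (e r).1 = k ∨ (e r).2 = k)).card : ℝ)
      < 2 * m * ((∑ u ∈ A, μ k u) * ∑ u ∈ Aᶜ, μ k u))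
    (hirr : IsIrreducible (fun x y : Fin (K + 1) → S => t * ptGraphSwap μ e φ x y + (1 - t) * prodKernel w M x y))
    {ε : ℝ} (hε : 0 < ε) (hε2 : ε ≤ 1 / 2)
    (hmix : ∃ n, worstTvDist (fun x y : Fin (K + 1) → S => t * ptGraphSwap μ e φ x y + (1 - t) * prodKernel w M x y)
      (tensorFun μ) n ≤ ε) :
    (2 * m * ((∑ u ∈ A, μ k u) * ∑ u ∈ Aᶜ, μ k u)
          / (t * ((univ.filter (fun r : Fin m => (e r).1 = k ∨ (e r).2 = k)).card : ℝ)) - 1) * Real.log (1 / (2 * ε))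
      ≤ (mixingTime (fun x y : Fin (K + 1) → S => t * ptGraphSwap μ e φ x y + (1 - t) * prodKernel w M x y)
          (tensorFun μ) ε : ℝ) := by
  have hmpos : (0 : ℝ) < m := Nat.cast_pos.mpr (by omega)
  have hP := weightedScheme_isRowStochastic (t := t) (w := w) (ptGraphSwap_isRowStochastic (e := e) (φ := φ) hμ) hM
    hw0 hw1 ht0 ht1
  have hDB := weightedScheme_detailedBalance (w := w) (ptGraphSwap_detailedBalance (e := e) (φ := φ) hμ) hMrev t
  have hgap := leastConnected_spectralGap_le (t := t) (M := M) (e := e) (φ := φ) (w := w) hm he hμ hμ1 hM hMrev hw0 hw1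
    ht0 ht1 hφA k hAk hidle
  have hu : t * ((univ.filter (fun r : Fin m => (e r).1 = k ∨ (e r).2 = k)).card : ℝ)
      / (2 * m * ((∑ u ∈ A, μ k u) * ∑ u ∈ Aᶜ, μ k u)) < 1 := by
    rw [div_lt_one (by positivity)]; exact hsmall
  rw [← inv_div_sub_one]
  exact mixingTime_ge_of_spectralGap_le (tensorFun_pos hμ) (sum_tensorFun_eq_one μ hμ1) hP hDB hirr hgap hu hε hε2 hmix

/-- **COLD-START FLOOR FROM THE MEASURED ACCEPTANCES:** as above with `t·Σ_{r∋k}α_r < 2m·μ_k(A)μ_k(Aᶜ)`: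
**`t_mix(ε) ≥ (2m·μ_k(A)μ_k(Aᶜ)/(t·Σ_{r∋k}α_r) − 1)·log(1/(2ε))`**. [ours] -/
theorem acceptance_mixingTime_ge [Nontrivial S] (hm : 1 ≤ m) (he : ∀ r, (e r).1 ≠ (e r).2) (hμ : ∀ k x, 0 < μ k x)
    (hμ1 : ∀ k, ∑ u, μ k u = 1) (hM : ∀ k, IsRowStochastic (M k)) (hMrev : ∀ k, DetailedBalance (μ k) (M k))
    (hw0 : ∀ k, 0 ≤ w k) (hw1 : ∑ k, w k = 1) (ht0 : 0 ≤ t) (ht1 : t ≤ 1) {A : Finset S}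
    (hφA : ∀ r u, φ r u ∈ A ↔ u ∈ A) (k : Fin (K + 1)) (hAk : 0 < (∑ u ∈ A, μ k u) * ∑ u ∈ Aᶜ, μ k u)
    (hidle : w k * edgeMeasure (μ k) (M k) A Aᶜ = 0)
    (hsmall : t * (∑ r ∈ univ.filter (fun r : Fin m => (e r).1 = k ∨ (e r).2 = k),
        ∑ x : Fin (K + 1) → S, min (tensorFun μ x) (tensorFun μ (edgeFlowSwap (φ r) (e r).1 (e r).2 x)))
      < 2 * m * ((∑ u ∈ A, μ k u) * ∑ u ∈ Aᶜ, μ k u))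
    (hirr : IsIrreducible (fun x y : Fin (K + 1) → S => t * ptGraphSwap μ e φ x y + (1 - t) * prodKernel w M x y))
    {ε : ℝ} (hε : 0 < ε) (hε2 : ε ≤ 1 / 2)
    (hmix : ∃ n, worstTvDist (fun x y : Fin (K + 1) → S => t * ptGraphSwap μ e φ x y + (1 - t) * prodKernel w M x y)
      (tensorFun μ) n ≤ ε) :
    (2 * m * ((∑ u ∈ A, μ k u) * ∑ u ∈ Aᶜ, μ k u)
          / (t * ∑ r ∈ univ.filter (fun r : Fin m => (e r).1 = k ∨ (e r).2 = k),
              ∑ x : Fin (K + 1) → S, min (tensorFun μ x) (tensorFun μ (edgeFlowSwap (φ r) (e r).1 (e r).2 x))) - 1)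
        * Real.log (1 / (2 * ε))
      ≤ (mixingTime (fun x y : Fin (K + 1) → S => t * ptGraphSwap μ e φ x y + (1 - t) * prodKernel w M x y)
          (tensorFun μ) ε : ℝ) := by
  have hmpos : (0 : ℝ) < m := Nat.cast_pos.mpr (by omega)
  have hP := weightedScheme_isRowStochastic (t := t) (w := w) (ptGraphSwap_isRowStochastic (e := e) (φ := φ) hμ) hM
    hw0 hw1 ht0 ht1
  have hDB := weightedScheme_detailedBalance (w := w) (ptGraphSwap_detailedBalance (e := e) (φ := φ) hμ) hMrev t
  have hgap := acceptance_spectralGap_le (t := t) (M := M) (e := e) (φ := φ) (w := w) hm he hμ hμ1 hM hMrev hw0 hw1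
    ht0 ht1 hφA k hAk hidle
  have hu : t * (∑ r ∈ univ.filter (fun r : Fin m => (e r).1 = k ∨ (e r).2 = k),
        ∑ x : Fin (K + 1) → S, min (tensorFun μ x) (tensorFun μ (edgeFlowSwap (φ r) (e r).1 (e r).2 x)))
      / (2 * m * ((∑ u ∈ A, μ k u) * ∑ u ∈ Aᶜ, μ k u)) < 1 := by
    rw [div_lt_one (by positivity)]; exact hsmall
  rw [← inv_div_sub_one]
  exact mixingTime_ge_of_spectralGap_le (tensorFun_pos hμ) (sum_tensorFun_eq_one μ hμ1) hP hDB hirr hgap hu hε hε2 hmix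

/-- **COLD-START FLOOR FROM THE HOT DEGREE:** all cold replicas idle, `μ_k(A)μ_k(Aᶜ) ≥ v > 0` (`k ≠ 0`), `K, m ≥ 1`,
`t·h·min{μ_0(A),μ_0(Aᶜ)} < m·K·v`: **`t_mix(ε) ≥ (m·K·v/(t·h·min{μ_0(A),μ_0(Aᶜ)}) − 1)·log(1/(2ε))`**. [ours] -/
theorem dilutedHandover_mixingTime_ge [Nontrivial S] (hK : 1 ≤ K) (hm : 1 ≤ m) (he : ∀ r, (e r).1 ≠ (e r).2)
    (hμ : ∀ k x, 0 < μ k x) (hμ1 : ∀ k, ∑ u, μ k u = 1) (hM : ∀ k, IsRowStochastic (M k))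
    (hMrev : ∀ k, DetailedBalance (μ k) (M k)) (hw0 : ∀ k, 0 ≤ w k) (hw1 : ∑ k, w k = 1) (ht0 : 0 ≤ t)
    (ht1 : t ≤ 1) {A : Finset S} (hφA : ∀ r u, φ r u ∈ A ↔ u ∈ A) {v : ℝ} (hvpos : 0 < v)
    (hv : ∀ k : Fin (K + 1), k ≠ 0 → v ≤ (∑ u ∈ A, μ k u) * ∑ u ∈ Aᶜ, μ k u)
    (hidle : ∀ k : Fin (K + 1), k ≠ 0 → w k * edgeMeasure (μ k) (M k) A Aᶜ = 0)
    (hsmall : t * ((univ.filter fun r : Fin m => (e r).1 = 0 ∨ (e r).2 = 0).card : ℝ)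
        * min (∑ u ∈ A, μ 0 u) (∑ u ∈ Aᶜ, μ 0 u) < m * K * v)
    (hirr : IsIrreducible (fun x y : Fin (K + 1) → S => t * ptGraphSwap μ e φ x y + (1 - t) * prodKernel w M x y))
    {ε : ℝ} (hε : 0 < ε) (hε2 : ε ≤ 1 / 2)
    (hmix : ∃ n, worstTvDist (fun x y : Fin (K + 1) → S => t * ptGraphSwap μ e φ x y + (1 - t) * prodKernel w M x y)
      (tensorFun μ) n ≤ ε) :
    (m * K * v / (t * ((univ.filter fun r : Fin m => (e r).1 = 0 ∨ (e r).2 = 0).card : ℝ)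
          * min (∑ u ∈ A, μ 0 u) (∑ u ∈ Aᶜ, μ 0 u)) - 1) * Real.log (1 / (2 * ε))
      ≤ (mixingTime (fun x y : Fin (K + 1) → S => t * ptGraphSwap μ e φ x y + (1 - t) * prodKernel w M x y)
          (tensorFun μ) ε : ℝ) := by
  have hKpos : (0 : ℝ) < K := Nat.cast_pos.mpr (by omega)
  have hmpos : (0 : ℝ) < m := Nat.cast_pos.mpr (by omega)
  have hP := weightedScheme_isRowStochastic (t := t) (w := w) (ptGraphSwap_isRowStochastic (e := e) (φ := φ) hμ) hM
    hw0 hw1 ht0 ht1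
  have hDB := weightedScheme_detailedBalance (w := w) (ptGraphSwap_detailedBalance (e := e) (φ := φ) hμ) hMrev t
  have hgap := dilutedHandover_spectralGap_le hK hm he hμ hμ1 hM hMrev hw0 hw1 ht0 ht1 hφA hvpos hv hidle
  have hu : t * ((univ.filter fun r : Fin m => (e r).1 = 0 ∨ (e r).2 = 0).card : ℝ)
      * min (∑ u ∈ A, μ 0 u) (∑ u ∈ Aᶜ, μ 0 u) / (m * K * v) < 1 := by
    rw [div_lt_one (by positivity)]; exact hsmall
  rw [← inv_div_sub_one]
  exact mixingTime_ge_of_spectralGap_le (tensorFun_pos hμ) (sum_tensorFun_eq_one μ hμ1) hP hDB hirr hgap hu hε hε2 hmix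

end Summit.Ventures.LatticeQCDFlow.Scaling

end
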